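import Literature.Analysis.FluidPDE.CoordDerivatives
import Mathlib.Algebra.Order.Chebyshev
import Mathlib.MeasureTheory.Function.L2Space
import HarnessLib

/-!
# Linear differential expressions of order `≤ 2` and the `L²` size of their commutators with
# word derivatives

Analysis/PDE support file (everything proved, no named facts), generic bookkeeping for the
higher-order energy estimates of the existence proof for linear hyperbolic equations by the
regularised evolution (S. Alinhac, *Hyperbolic Partial Differential Equations* (2009), proof of
Thm. 7.11, Step 2 (c): the systems "governing `v_α = ∂ₓ^α ũ`" differ from the original one by
commutators `[∂^α, coefficients]`, which "are bounded operators … with fixed constants independent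
of `ε`"; L. Hörmander, *Lectures on Nonlinear Hyperbolic Differential Equations* (1997), proof of
Thm. 6.3.2: "differentiate the equation … and apply (6.3.7) to the derivatives").

On `𝔼 = ℝ³` with the coordinate calculus of `FluidPDE/CoordDerivatives` (`pderiv`, `ipderiv`,
`dnorm`):

* `DOp` — the differential monomials `1, ∂ᵢ, ∂ᵢ∂ⱼ`; `DTerm` — a term `κ · D(f or h)` of a linear
  differential expression in a pair `(f, h)`; `evalD P f h` — the expression `∑_τ κ_τ D_τ(arg_τ)`;
* the **commutator identity** `∂^w (P(f,h)) − P(∂^w f, ∂^w h) = ∑_τ (∂^w(κ_τ g_τ) − κ_τ ∂^w g_τ)`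
  (`ipderiv_evalD_sub_eq`) and its **pointwise bound** by
  `2^k M ∑_τ ∑_{a=1}^{k} |∇^{k−a+ord τ} arg_τ|` (`abs_ipderiv_evalD_sub_le`, from the tree's Leibniz
  remainder bound `abs_ipderiv_mul_sub_mul_ipderiv_le`), with `M` a bound for `|∇^a κ_τ|`,
  `1 ≤ a ≤ k`;
* the **product-rule defect** `P(∂ⱼF, ∂ⱼH) − ∂ⱼ(P(F,H)) = −∑_τ (∂ⱼκ_τ) g_τ(F,H)`
  (`evalD_pderiv_sub_pderiv_evalD`) and its pointwise bound;
* the passage from pointwise bounds by finitely many `|∇^m g|` to `L²` bounds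
  (`integral_sq_le_of_abs_le_sum`, Cauchy–Schwarz on the finite sum).

## References

* S. Alinhac, *Hyperbolic Partial Differential Equations*, Springer (2009), proof of Thm. 7.11,
  Step 2 (c). [`AlinhacHPDE2009`]
* L. Hörmander, *Lectures on Nonlinear Hyperbolic Differential Equations* (1997), §6.3, proof of
  Thm. 6.3.2. [`Hormander1997`]
-/

noncomputable section

open MeasureTheory Set Function Filter Finset
open scoped BigOperators ContDiff Topology

namespace Literature.Analysis.PDE

open Literature.Analysis.FluidPDE

/-- Euclidean `3`-space (local notation). -/
local notation "𝔼" => EuclideanSpace ℝ (Fin 3)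

/-! ### Differential monomials of order at most two -/

/-- The differential monomials `1`, `∂ᵢ`, `∂ᵢ∂ⱼ`. [folklore] -/
inductive DOp
  | id : DOp
  | d : Fin 3 → DOp
  | dd : Fin 3 → Fin 3 → DOp

namespace DOp

/-- The order of a monomial. [folklore] -/
def order : DOp → ℕ
  | id => 0
  | d _ => 1
  | dd _ _ => 2

/-- The action of a monomial on functions. [folklore] -/
def apply : DOp → (𝔼 → ℝ) → 𝔼 → ℝ
  | id, f => f
  | d i, f => pderiv i f
  | dd i j, f => pderiv i (pderiv j f)

/-- `order ≤ 2`. [folklore] -/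
theorem order_le_two : ∀ op : DOp, op.order ≤ 2
  | id => by simp [order]
  | d _ => by simp [order]
  | dd _ _ => by simp [order]

/-- Monomials preserve smoothness. [folklore] -/
theorem contDiff_apply {f : 𝔼 → ℝ} (hf : ContDiff ℝ ∞ f) : ∀ op : DOp, ContDiff ℝ ∞ (op.apply f)
  | id => hf
  | d i => contDiff_pderiv hf i
  | dd i j => contDiff_pderiv (contDiff_pderiv hf j) i

/-- Monomials commute with `∂ₗ` on smooth functions. [folklore] -/
theorem apply_pderiv {f : 𝔼 → ℝ} (hf : ContDiff ℝ ∞ f) (l : Fin 3) :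
    ∀ op : DOp, op.apply (pderiv l f) = pderiv l (op.apply f)
  | id => rfl
  | d i => by show pderiv i (pderiv l f) = pderiv l (pderiv i f); rw [pderiv_comm hf]
  | dd i j => by
      show pderiv i (pderiv j (pderiv l f)) = pderiv l (pderiv i (pderiv j f))
      rw [pderiv_comm hf j l, pderiv_comm (contDiff_pderiv hf j) i l]

/-- Monomials commute with word derivatives on smooth functions. [folklore] -/
theorem apply_ipderiv {f : 𝔼 → ℝ} (hf : ContDiff ℝ ∞ f) (op : DOp) :
    ∀ {m : ℕ} (w : Fin m → Fin 3), op.apply (ipderiv w f) = ipderiv w (op.apply f)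
  | 0, _ => rfl
  | m + 1, w => by
      rw [ipderiv_succ, ipderiv_succ, apply_pderiv (contDiff_ipderiv hf _) _ op,
        apply_ipderiv hf op (Fin.tail w)]

/-- `|∇^b (D f)| ≤ |∇^{b + ord D} f|`. [folklore] -/
theorem dnorm_apply_le {f : 𝔼 → ℝ} (hf : ContDiff ℝ ∞ f) (b : ℕ) (x : 𝔼) :
    ∀ op : DOp, dnorm b (op.apply f) x ≤ dnorm (b + op.order) f x
  | id => by simp [apply, order]
  | d i => dnorm_pderiv_le hf b i x
  | dd i j => by
      show dnorm b (pderiv i (pderiv j f)) x ≤ dnorm (b + 2) f x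
      exact (dnorm_pderiv_le (contDiff_pderiv hf j) b i x).trans (dnorm_pderiv_le hf (b + 1) j x)

/-- A monomial applied to a function vanishing near `x` vanishes at `x`. [folklore] -/
theorem apply_eq_zero_of_notMem_tsupport {f : 𝔼 → ℝ} {x : 𝔼} (hx : x ∉ tsupport f) :
    ∀ op : DOp, op.apply f x = 0
  | id => image_eq_zero_of_notMem_tsupport hx
  | d i => by
      show pderiv i f x = 0
      rw [pderiv_apply, fderiv_of_notMem_tsupport ℝ hx]; rfl
  | dd i j => by
      show pderiv i (pderiv j f) x = 0
      have hx' : x ∉ tsupport (pderiv j f) := fun h => hx (tsupport_fderiv_apply_subset ℝ (stdVec j) h)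
      rw [pderiv_apply, fderiv_of_notMem_tsupport ℝ hx']; rfl

/-- `tsupport (D f) ⊆ tsupport f`. [folklore] -/
theorem tsupport_apply_subset (f : 𝔼 → ℝ) : ∀ op : DOp, tsupport (op.apply f) ⊆ tsupport f
  | id => subset_rfl
  | d i => tsupport_fderiv_apply_subset ℝ (stdVec i)
  | dd i j => (tsupport_fderiv_apply_subset ℝ (stdVec i)).trans
      (tsupport_fderiv_apply_subset ℝ (stdVec j))

end DOp

/-! ### Linear differential expressions in a pair `(f, h)` -/

/-- A term `κ · D(arg)` of a linear differential expression in a pair `(f, h)`: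
coefficient, monomial, and which member of the pair it acts on. [folklore] -/
structure DTerm where
  /-- the coefficient -/
  κ : 𝔼 → ℝ
  /-- the differential monomial -/
  op : DOp
  /-- `true`: acts on the first member `f`; `false`: on the second member `h` -/
  onFst : Bool

namespace DTerm

/-- The argument the term acts on. [folklore] -/
def arg (τ : DTerm) (f h : 𝔼 → ℝ) : 𝔼 → ℝ := bif τ.onFst then f else h

/-- The differentiated argument `g_τ = D_τ (arg_τ)`. [folklore] -/
def g (τ : DTerm) (f h : 𝔼 → ℝ) : 𝔼 → ℝ := τ.op.apply (τ.arg f h)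

/-- `arg` is smooth. [folklore] -/
theorem contDiff_arg (τ : DTerm) {f h : 𝔼 → ℝ} (hf : ContDiff ℝ ∞ f) (hh : ContDiff ℝ ∞ h) :
    ContDiff ℝ ∞ (τ.arg f h) := by
  unfold arg; cases τ.onFst <;> simpa

/-- `g` is smooth. [folklore] -/
theorem contDiff_g (τ : DTerm) {f h : 𝔼 → ℝ} (hf : ContDiff ℝ ∞ f) (hh : ContDiff ℝ ∞ h) :
    ContDiff ℝ ∞ (τ.g f h) :=
  DOp.contDiff_apply (τ.contDiff_arg hf hh) _

/-- `arg` commutes with word derivatives. [folklore] -/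
theorem arg_ipderiv (τ : DTerm) (f h : 𝔼 → ℝ) {m : ℕ} (w : Fin m → Fin 3) :
    τ.arg (ipderiv w f) (ipderiv w h) = ipderiv w (τ.arg f h) := by
  unfold arg; cases τ.onFst <;> rfl

/-- `arg` commutes with `∂ⱼ`. [folklore] -/
theorem arg_pderiv (τ : DTerm) (f h : 𝔼 → ℝ) (j : Fin 3) :
    τ.arg (pderiv j f) (pderiv j h) = pderiv j (τ.arg f h) := by
  unfold arg; cases τ.onFst <;> rfl

/-- `g(∂^w f, ∂^w h) = ∂^w g(f, h)`. [folklore] -/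
theorem g_ipderiv (τ : DTerm) {f h : 𝔼 → ℝ} (hf : ContDiff ℝ ∞ f) (hh : ContDiff ℝ ∞ h) {m : ℕ}
    (w : Fin m → Fin 3) : τ.g (ipderiv w f) (ipderiv w h) = ipderiv w (τ.g f h) := by
  unfold g
  rw [arg_ipderiv, DOp.apply_ipderiv (τ.contDiff_arg hf hh)]

/-- `g(∂ⱼ F, ∂ⱼ H) = ∂ⱼ g(F, H)`. [folklore] -/
theorem g_pderiv (τ : DTerm) {f h : 𝔼 → ℝ} (hf : ContDiff ℝ ∞ f) (hh : ContDiff ℝ ∞ h)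
    (j : Fin 3) : τ.g (pderiv j f) (pderiv j h) = pderiv j (τ.g f h) := by
  unfold g
  rw [arg_pderiv, DOp.apply_pderiv (τ.contDiff_arg hf hh)]

/-- `|∇^b g_τ| ≤ |∇^{b + ord τ} arg_τ|`. [folklore] -/
theorem dnorm_g_le (τ : DTerm) {f h : 𝔼 → ℝ} (hf : ContDiff ℝ ∞ f) (hh : ContDiff ℝ ∞ h) (b : ℕ)
    (x : 𝔼) : dnorm b (τ.g f h) x ≤ dnorm (b + τ.op.order) (τ.arg f h) x :=
  DOp.dnorm_apply_le (τ.contDiff_arg hf hh) b x _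

end DTerm

/-- The linear differential expression `P(f, h) = ∑_τ κ_τ · D_τ(arg_τ)`. [folklore] -/
def evalD {ι : Type*} [Fintype ι] (P : ι → DTerm) (f h : 𝔼 → ℝ) (x : 𝔼) : ℝ :=
  ∑ τ, (P τ).κ x * (P τ).g f h x

section Expr

variable {ι : Type*} [Fintype ι] {P : ι → DTerm}

/-- `P(f, h)` is smooth for smooth coefficients and arguments. [folklore] -/
theorem contDiff_evalD (hP : ∀ τ, ContDiff ℝ ∞ (P τ).κ) {f h : 𝔼 → ℝ} (hf : ContDiff ℝ ∞ f)
    (hh : ContDiff ℝ ∞ h) : ContDiff ℝ ∞ (evalD P f h) := by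
  unfold evalD
  exact ContDiff.sum fun τ _ => (hP τ).mul ((P τ).contDiff_g hf hh)

/-- `P(f, h)` is linear: additivity. [folklore] -/
theorem evalD_add {f f' h h' : 𝔼 → ℝ} (hf : ContDiff ℝ ∞ f)
    (hf' : ContDiff ℝ ∞ f') (hh : ContDiff ℝ ∞ h) (hh' : ContDiff ℝ ∞ h') (x : 𝔼) :
    evalD P (fun y => f y + f' y) (fun y => h y + h' y) x = evalD P f h x + evalD P f' h' x := by
  have hinf : (∞ : WithTop ℕ∞) ≠ 0 := by simp
  unfold evalD
  rw [← Finset.sum_add_distrib]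
  refine Finset.sum_congr rfl fun τ _ => ?_
  have hg : (P τ).g (fun y => f y + f' y) (fun y => h y + h' y) x =
      (P τ).g f h x + (P τ).g f' h' x := by
    unfold DTerm.g DTerm.arg
    cases (P τ).onFst
    · simp only [cond_false]
      cases (P τ).op with
      | id => rfl
      | d i => exact congrFun (pderiv_add (hh.differentiable hinf) (hh'.differentiable hinf) i) x
      | dd i j =>
          show pderiv i (pderiv j fun y => h y + h' y) x = _
          rw [pderiv_add (hh.differentiable hinf) (hh'.differentiable hinf) j]
          exact congrFun (pderiv_add ((contDiff_pderiv hh j).differentiable hinf)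
            ((contDiff_pderiv hh' j).differentiable hinf) i) x
    · simp only [cond_true]
      cases (P τ).op with
      | id => rfl
      | d i => exact congrFun (pderiv_add (hf.differentiable hinf) (hf'.differentiable hinf) i) x
      | dd i j =>
          show pderiv i (pderiv j fun y => f y + f' y) x = _
          rw [pderiv_add (hf.differentiable hinf) (hf'.differentiable hinf) j]
          exact congrFun (pderiv_add ((contDiff_pderiv hf j).differentiable hinf)
            ((contDiff_pderiv hf' j).differentiable hinf) i) x
  rw [hg]; ring

/-- `P(f, h)` is linear: homogeneity. [folklore] -/
theorem evalD_smul {f h : 𝔼 → ℝ} (hf : ContDiff ℝ ∞ f)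
    (hh : ContDiff ℝ ∞ h) (r : ℝ) (x : 𝔼) :
    evalD P (fun y => r * f y) (fun y => r * h y) x = r * evalD P f h x := by
  have hinf : (∞ : WithTop ℕ∞) ≠ 0 := by simp
  unfold evalD
  rw [Finset.mul_sum]
  refine Finset.sum_congr rfl fun τ _ => ?_
  have hg : (P τ).g (fun y => r * f y) (fun y => r * h y) x = r * (P τ).g f h x := by
    unfold DTerm.g DTerm.arg
    cases (P τ).onFst
    · simp only [cond_false]
      cases (P τ).op with
      | id => rfl
      | d i => exact congrFun (pderiv_const_mul (hh.differentiable hinf) r i) x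
      | dd i j =>
          show pderiv i (pderiv j fun y => r * h y) x = _
          rw [pderiv_const_mul (hh.differentiable hinf) r j]
          exact congrFun (pderiv_const_mul ((contDiff_pderiv hh j).differentiable hinf) r i) x
    · simp only [cond_true]
      cases (P τ).op with
      | id => rfl
      | d i => exact congrFun (pderiv_const_mul (hf.differentiable hinf) r i) x
      | dd i j =>
          show pderiv i (pderiv j fun y => r * f y) x = _
          rw [pderiv_const_mul (hf.differentiable hinf) r j]
          exact congrFun (pderiv_const_mul ((contDiff_pderiv hf j).differentiable hinf) r i) x
  rw [hg]; ring

/-- `P(f, h)` vanishes off the supports of the coefficients. [folklore] -/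
theorem evalD_eq_zero_of_forall_notMem (f h : 𝔼 → ℝ) {x : 𝔼} (hx : ∀ τ, x ∉ tsupport (P τ).κ) :
    evalD P f h x = 0 := by
  unfold evalD
  exact Finset.sum_eq_zero fun τ _ => by rw [image_eq_zero_of_notMem_tsupport (hx τ), zero_mul]

/-- **The commutator identity**:
`∂^w (P(f, h)) − P(∂^w f, ∂^w h) = ∑_τ (∂^w (κ_τ g_τ) − κ_τ ∂^w g_τ)`. [cite: AlinhacHPDE2009, Thm. 7.11 proof Step 2 (c)] -/
theorem ipderiv_evalD_sub_eq (hP : ∀ τ, ContDiff ℝ ∞ (P τ).κ) {f h : 𝔼 → ℝ} (hf : ContDiff ℝ ∞ f)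
    (hh : ContDiff ℝ ∞ h) {m : ℕ} (w : Fin m → Fin 3) (x : 𝔼) :
    ipderiv w (evalD P f h) x - evalD P (ipderiv w f) (ipderiv w h) x =
      ∑ τ, (ipderiv w (fun y => (P τ).κ y * (P τ).g f h y) x -
        (P τ).κ x * ipderiv w ((P τ).g f h) x) := by
  have h1 : ipderiv w (evalD P f h) x = ∑ τ, ipderiv w (fun y => (P τ).κ y * (P τ).g f h y) x := by
    have he : evalD P f h = fun y => ∑ τ, (P τ).κ y * (P τ).g f h y := rfl
    rw [he, ipderiv_finset_sum univ (fun τ => (hP τ).mul ((P τ).contDiff_g hf hh)) w]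
  have h2 : evalD P (ipderiv w f) (ipderiv w h) x = ∑ τ, (P τ).κ x * ipderiv w ((P τ).g f h) x := by
    unfold evalD
    exact Finset.sum_congr rfl fun τ _ => by rw [(P τ).g_ipderiv hf hh w]
  rw [h1, h2, ← Finset.sum_sub_distrib]

/-- **Pointwise bound of the commutator**: with `|∇^a κ_τ| ≤ M` for `1 ≤ a ≤ k`,
`|∂^w P(f,h) − P(∂^w f, ∂^w h)| ≤ 2^k M ∑_τ ∑_{a=1}^{k} |∇^{k−a+ord τ} arg_τ|`.
[cite: AlinhacHPDE2009, Thm. 7.11 proof Step 2 (c)] -/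
theorem abs_ipderiv_evalD_sub_le (hP : ∀ τ, ContDiff ℝ ∞ (P τ).κ) {f h : 𝔼 → ℝ}
    (hf : ContDiff ℝ ∞ f) (hh : ContDiff ℝ ∞ h) {k : ℕ} (w : Fin k → Fin 3) {M : ℝ} (hM0 : 0 ≤ M)
    (hM : ∀ τ, ∀ a ∈ Finset.Icc 1 k, ∀ y, dnorm a (P τ).κ y ≤ M) (x : 𝔼) :
    |ipderiv w (evalD P f h) x - evalD P (ipderiv w f) (ipderiv w h) x| ≤
      2 ^ k * M * ∑ τ, ∑ a ∈ Finset.Icc 1 k, dnorm (k - a + (P τ).op.order) ((P τ).arg f h) x := by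
  rw [ipderiv_evalD_sub_eq hP hf hh w x]
  calc |∑ τ, (ipderiv w (fun y => (P τ).κ y * (P τ).g f h y) x -
        (P τ).κ x * ipderiv w ((P τ).g f h) x)|
      ≤ ∑ τ, |ipderiv w (fun y => (P τ).κ y * (P τ).g f h y) x -
          (P τ).κ x * ipderiv w ((P τ).g f h) x| := Finset.abs_sum_le_sum_abs _ _
    _ ≤ ∑ τ, 2 ^ k * ∑ a ∈ Finset.Icc 1 k, dnorm a (P τ).κ x * dnorm (k - a) ((P τ).g f h) x :=
        Finset.sum_le_sum fun τ _ =>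
          abs_ipderiv_mul_sub_mul_ipderiv_le (hP τ) ((P τ).contDiff_g hf hh) w x
    _ ≤ ∑ τ, 2 ^ k * ∑ a ∈ Finset.Icc 1 k, M * dnorm (k - a + (P τ).op.order) ((P τ).arg f h) x :=
        Finset.sum_le_sum fun τ _ => mul_le_mul_of_nonneg_left
          (Finset.sum_le_sum fun a ha => mul_le_mul (hM τ a ha x)
            ((P τ).dnorm_g_le hf hh (k - a) x) (dnorm_nonneg _ _ _) hM0) (by positivity)
    _ = 2 ^ k * M * ∑ τ, ∑ a ∈ Finset.Icc 1 k, dnorm (k - a + (P τ).op.order) ((P τ).arg f h) x := by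
        rw [Finset.mul_sum]
        refine Finset.sum_congr rfl fun τ _ => ?_
        rw [Finset.mul_sum, Finset.mul_sum]
        exact Finset.sum_congr rfl fun a _ => by ring

/-- Re-indexing the orders: `∑_{a=1}^{k} |∇^{k−a+n} g| ≤ k ∑_{m<k+n} |∇^m g|`. [folklore] -/
theorem sum_Icc_dnorm_le (k n : ℕ) (g : 𝔼 → ℝ) (x : 𝔼) :
    ∑ a ∈ Finset.Icc 1 k, dnorm (k - a + n) g x ≤ k * ∑ m ∈ Finset.range (k + n), dnorm m g x := by
  have h : ∀ a ∈ Finset.Icc 1 k, dnorm (k - a + n) g x ≤ ∑ m ∈ Finset.range (k + n), dnorm m g x := by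
    intro a ha
    rw [Finset.mem_Icc] at ha
    refine Finset.single_le_sum (f := fun m => dnorm m g x) (fun m _ => dnorm_nonneg _ _ _) ?_
    rw [Finset.mem_range]; omega
  calc ∑ a ∈ Finset.Icc 1 k, dnorm (k - a + n) g x
      ≤ (Finset.Icc 1 k).card • ∑ m ∈ Finset.range (k + n), dnorm m g x := Finset.sum_le_card_nsmul _ _ _ h
    _ = k * ∑ m ∈ Finset.range (k + n), dnorm m g x := by rw [Nat.card_Icc, nsmul_eq_mul]; simp

/-- **The product-rule defect**: `P(∂ⱼF, ∂ⱼH) − ∂ⱼ(P(F, H)) = −∑_τ (∂ⱼκ_τ) g_τ(F, H)`. [folklore] -/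
theorem evalD_pderiv_sub_pderiv_evalD (hP : ∀ τ, ContDiff ℝ ∞ (P τ).κ) {F H : 𝔼 → ℝ}
    (hF : ContDiff ℝ ∞ F) (hH : ContDiff ℝ ∞ H) (j : Fin 3) (x : 𝔼) :
    evalD P (pderiv j F) (pderiv j H) x - pderiv j (evalD P F H) x =
      -∑ τ, pderiv j (P τ).κ x * (P τ).g F H x := by
  have hinf : (∞ : WithTop ℕ∞) ≠ 0 := by simp
  have he : evalD P F H = fun y => ∑ τ, (P τ).κ y * (P τ).g F H y := rfl
  have hd : pderiv j (evalD P F H) x =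
      ∑ τ, (pderiv j (P τ).κ x * (P τ).g F H x + (P τ).κ x * pderiv j ((P τ).g F H) x) := by
    rw [he, pderiv_sum (f := fun τ y => (P τ).κ y * (P τ).g F H y) univ (fun τ _ =>
      ((hP τ).differentiable hinf).fun_mul (((P τ).contDiff_g hF hH).differentiable hinf))]
    refine Finset.sum_congr rfl fun τ _ => ?_
    rw [pderiv_mul ((hP τ).differentiable hinf) (((P τ).contDiff_g hF hH).differentiable hinf)]
  have h1 : evalD P (pderiv j F) (pderiv j H) x = ∑ τ, (P τ).κ x * pderiv j ((P τ).g F H) x := by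
    unfold evalD
    exact Finset.sum_congr rfl fun τ _ => by rw [(P τ).g_pderiv hF hH j]
  rw [hd, h1, ← Finset.sum_neg_distrib, ← sub_eq_zero, ← Finset.sum_sub_distrib,
    ← Finset.sum_sub_distrib]
  exact Finset.sum_eq_zero fun τ _ => by ring

/-- **Pointwise bound of the product-rule defect**: with `|∇¹ κ_τ| ≤ M`,
`|P(∂ⱼF, ∂ⱼH) − ∂ⱼ(P(F,H))| ≤ M ∑_τ |∇^{ord τ} arg_τ(F, H)|`. [folklore] -/
theorem abs_evalD_pderiv_sub_pderiv_evalD_le (hP : ∀ τ, ContDiff ℝ ∞ (P τ).κ) {F H : 𝔼 → ℝ}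
    (hF : ContDiff ℝ ∞ F) (hH : ContDiff ℝ ∞ H) (j : Fin 3) {M : ℝ} (hM0 : 0 ≤ M)
    (hM : ∀ τ y, dnorm 1 (P τ).κ y ≤ M) (x : 𝔼) :
    |evalD P (pderiv j F) (pderiv j H) x - pderiv j (evalD P F H) x| ≤
      M * ∑ τ, dnorm (P τ).op.order ((P τ).arg F H) x := by
  rw [evalD_pderiv_sub_pderiv_evalD hP hF hH j x, abs_neg, Finset.mul_sum]
  refine (Finset.abs_sum_le_sum_abs _ _).trans (Finset.sum_le_sum fun τ _ => ?_)
  rw [abs_mul]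
  have h1 : |pderiv j (P τ).κ x| ≤ M := by
    have h : pderiv j (P τ).κ x = ipderiv ![j] (P τ).κ x := rfl
    rw [h]
    exact (abs_ipderiv_le_dnorm _ _ _).trans (hM τ x)
  have h2 : |(P τ).g F H x| ≤ dnorm (P τ).op.order ((P τ).arg F H) x := by
    have h := (P τ).dnorm_g_le hF hH 0 x
    rw [dnorm_zero, zero_add] at h
    exact h
  exact mul_le_mul h1 h2 (abs_nonneg _) hM0

/-- **Pointwise bound for `P` itself**: with `|κ_τ| ≤ M`, `|P(F, H)| ≤ M ∑_τ |∇^{ord τ} arg_τ|`.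
[folklore] -/
theorem abs_evalD_le {F H : 𝔼 → ℝ} (hF : ContDiff ℝ ∞ F) (hH : ContDiff ℝ ∞ H) {M : ℝ}
    (hM0 : 0 ≤ M) (hM : ∀ τ y, |(P τ).κ y| ≤ M) (x : 𝔼) :
    |evalD P F H x| ≤ M * ∑ τ, dnorm (P τ).op.order ((P τ).arg F H) x := by
  unfold evalD
  rw [Finset.mul_sum]
  refine (Finset.abs_sum_le_sum_abs _ _).trans (Finset.sum_le_sum fun τ _ => ?_)
  rw [abs_mul]
  have h2 : |(P τ).g F H x| ≤ dnorm (P τ).op.order ((P τ).arg F H) x := by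
    have h := (P τ).dnorm_g_le hF hH 0 x
    rw [dnorm_zero, zero_add] at h
    exact h
  exact mul_le_mul (hM τ x) h2 (abs_nonneg _) hM0

end Expr

/-! ### From pointwise bounds by finitely many terms to `L²` bounds -/

/-- **Cauchy–Schwarz on a finite sum, integrated**: if `|R| ≤ C ∑ᵢ dᵢ` pointwise with
`dᵢ` square-integrable and `R` measurable, then
`∫ R² ≤ C² · card · ∑ᵢ ∫ dᵢ²`. [folklore] -/
theorem integral_sq_le_of_abs_le_sum {ι' : Type*} [Fintype ι'] {R : 𝔼 → ℝ} {d : ι' → 𝔼 → ℝ}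
    {C : ℝ} (hR : AEStronglyMeasurable R volume)
    (hd : ∀ i, Integrable (fun x => d i x ^ 2)) (h : ∀ x, |R x| ≤ C * ∑ i, d i x) :
    Integrable (fun x => R x ^ 2) ∧
      ∫ x, R x ^ 2 ≤ C ^ 2 * Fintype.card ι' * ∑ i, ∫ x, d i x ^ 2 := by
  have hpt : ∀ x, R x ^ 2 ≤ C ^ 2 * Fintype.card ι' * ∑ i, d i x ^ 2 := by
    intro x
    have h1 : R x ^ 2 ≤ (C * ∑ i, d i x) ^ 2 := by
      rw [← sq_abs (R x)]
      exact pow_le_pow_left₀ (abs_nonneg _) (h x) 2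
    have h2 : (∑ i, d i x) ^ 2 ≤ Fintype.card ι' * ∑ i, d i x ^ 2 := sq_sum_le_card_mul_sum_sq
    calc R x ^ 2 ≤ (C * ∑ i, d i x) ^ 2 := h1
      _ = C ^ 2 * (∑ i, d i x) ^ 2 := by ring
      _ ≤ C ^ 2 * (Fintype.card ι' * ∑ i, d i x ^ 2) := mul_le_mul_of_nonneg_left h2 (sq_nonneg _)
      _ = _ := by ring
  have hI : Integrable (fun x => C ^ 2 * Fintype.card ι' * ∑ i, d i x ^ 2) :=
    (integrable_finsetSum _ fun i _ => hd i).const_mul _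
  have hint : Integrable (fun x => R x ^ 2) :=
    hI.mono' (hR.pow 2) (ae_of_all _ fun x => by
      rw [Real.norm_of_nonneg (sq_nonneg _)]; exact hpt x)
  refine ⟨hint, ?_⟩
  calc ∫ x, R x ^ 2 ≤ ∫ x, C ^ 2 * Fintype.card ι' * ∑ i, d i x ^ 2 := integral_mono hint hI hpt
    _ = C ^ 2 * Fintype.card ι' * ∑ i, ∫ x, d i x ^ 2 := by
        rw [integral_const_mul, integral_finsetSum _ fun i _ => hd i]

/-- `∂^α g (x) = 0` for `x ∉ tsupport g`. [folklore] -/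
theorem ipderiv_eq_zero_of_notMem_tsupport {g : 𝔼 → ℝ} (hg : ContDiff ℝ ∞ g) :
    ∀ {m : ℕ} (α : Fin m → Fin 3) {x : 𝔼}, x ∉ tsupport g → ipderiv α g x = 0
  | 0, _, _, hx => image_eq_zero_of_notMem_tsupport hx
  | m + 1, α, x, hx => by
      rw [ipderiv_succ, pderiv_ipderiv hg,
        ipderiv_eq_zero_of_notMem_tsupport (contDiff_pderiv hg _) (Fin.tail α)]
      exact fun h => hx (tsupport_fderiv_apply_subset ℝ (stdVec (α 0)) h)

/-- `tsupport (∂^α g) ⊆ tsupport g`. [folklore] -/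
theorem tsupport_ipderiv_subset {g : 𝔼 → ℝ} (hg : ContDiff ℝ ∞ g) {m : ℕ} (α : Fin m → Fin 3) :
    tsupport (ipderiv α g) ⊆ tsupport g := by
  refine closure_minimal (fun x hx => ?_) (isClosed_tsupport g)
  by_contra h
  exact hx (ipderiv_eq_zero_of_notMem_tsupport hg α h)

/-- `dnorm m g` vanishes off the support of `g`. [folklore] -/
theorem dnorm_eq_zero_of_notMem_tsupport {g : 𝔼 → ℝ} (hg : ContDiff ℝ ∞ g) (m : ℕ) {x : 𝔼}
    (hx : x ∉ tsupport g) : dnorm m g x = 0 := by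
  unfold dnorm dnormSq
  rw [Finset.sum_eq_zero fun α _ => ?_, Real.sqrt_zero]
  rw [ipderiv_eq_zero_of_notMem_tsupport hg α hx, zero_pow two_ne_zero]

/-- `∫ (dnorm m g)²` is finite: integrability for `g ∈ C^∞_c`. [folklore] -/
theorem integrable_dnorm_sq {g : 𝔼 → ℝ} (hg : ContDiff ℝ ∞ g) (hgc : HasCompactSupport g) (m : ℕ) :
    Integrable (fun x => dnorm m g x ^ 2) := by
  have hc : Continuous fun x => dnorm m g x ^ 2 := (continuous_dnorm hg m).pow 2
  refine hc.integrable_of_hasCompactSupport ?_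
  refine HasCompactSupport.intro hgc fun x hx => ?_
  show dnorm m g x ^ 2 = 0
  rw [dnorm_eq_zero_of_notMem_tsupport hg m hx, zero_pow two_ne_zero]

end Literature.Analysis.PDE

end
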